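/-
Copyright: the b2b-balaban T⁴-continuum CRUX team, row NE7b leaf lineage `t4-ne7b-formalise-leaf-03` (gen 148). Project licence.
-/
import Mathlib.Analysis.Calculus.FDeriv.Bilinear
import Mathlib.Analysis.Calculus.FDeriv.Prod
import Mathlib.Analysis.Calculus.FDeriv.Add
import Mathlib.Analysis.Normed.Operator.Prod

/-!
# THE PRIMAL–DUAL (KKT) MAP `Φ(δ, λ) = (G δ, DV(δ) − λ ∘ DG(δ))` OF THE NONLINEAR-CONSTRAINT HARD STEP: ITS DERIVATIVE, AND THE
# CHART's SMALLNESS LETTER `‖DΦ(δ, λ) − 𝒦‖ ≤ 2‖DG δ − T‖ + ‖D²V δ − D²V δ₀‖ + ‖λ‖‖D²G δ − D²G δ₀‖ + ‖λ − λ₀‖‖D²G δ₀‖`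
# — the approximation letter `hΦ`∕`c` of `…HardStepChartRadius.exists_sliceBranch` for the KKT chart, from second-derivative moduli
# (row NE7b, node U5c; companion of `…AugmentedLagrangianEquivalence` (ALE: the KKT operator `𝒦` is an equivalence with `‖𝒦⁻¹‖ ≤ N`
# from kernel coercivity) — together they leave NO letter of the nonlinear-constraint chart abstract; idea-1 T-85 (L2) ∕ T-93 (b);
# [B11] CMP 102 (59)–(62) «contraction for ε₂ ≤ ⅛ε₃»; [folklore])

Cell `pub-balaban`, sub-cell `t4`, spine estimate NE7b (`T4WeightBudget.RelWeightBound`; the cell's OWN estimate — NOT PRINTED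
in [Bałaban 1983–89], NOT PROVED).  Crux-route work under `Spine/NE7b/` by leaf-03 (CRUX team (2), FREEZE (0) crux-prover clause).
NOTHING of Bałaban's is named, asserted, valued or discharged; no `T4Continuum/Support` leaf typed; no `def`; zero `sorry`.  Imports
Mathlib ONLY (`FDeriv.Bilinear` ∕ `.Prod` ∕ `.Add`, `Normed.Operator.Prod`) — independent of the `Spine/NE7b` olean frontier; nothing
of ALE ∕ AHE ∕ HSCR imported or restated (the KKT operator enters as the explicit continuous linear map below).

WHY.  ALE makes the KKT operator `𝒦(h, μ) = (T h, Q h − μ ∘ T)` (`T = DG(δ₀)`, `Q = D²V(δ₀) − λ₀ ∘ D²G(δ₀)`) an equivalence with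
an explicit inverse bound; HSCR's `exists_sliceBranch` then produces the KKT branch `w ↦ (δ(w), λ(w))` with radius and Lipschitz
constant ONCE the primal–dual map `Φ` approximates `𝒦` on a ball: `‖Φ x − Φ y − 𝒦(x − y)‖ ≤ c‖x − y‖`, which HSCR §2
(`approximatesLinearOn_of_norm_fderiv_sub_le`) reads off `‖DΦ(x) − 𝒦‖ ≤ c`.  This file computes `DΦ` (the bilinear term
`λ ∘ DG(δ)` differentiates by the Leibniz rule for `(μ, A) ↦ μ ∘ A`) and bounds `‖DΦ(δ, λ) − 𝒦‖` by the four moduli letters — so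
`c = 2a + b + Λe + ρ‖D²G(δ₀)‖` on a primal–dual ball where `‖DG − T‖ ≤ a`, `‖D²V − D²V(δ₀)‖ ≤ b`, `‖D²G − D²G(δ₀)‖ ≤ e`, `‖λ‖ ≤ Λ`,
`‖λ − λ₀‖ ≤ ρ`.

WHAT IS PROVED ([folklore]; the Leibniz rule for operator composition — Mathlib `IsBoundedBilinearMap.hasFDerivAt` of
`isBoundedBilinearMap_comp` — and operator-norm bookkeeping in the sup norm of products).  `E`, `F` real normed spaces; letters:
`G : E → F` with `G′ : E → (E →L F)`, `G″ : E → (E →L E →L F)`; the gradient functional `L : E → (E →L ℝ)` (= `DV`) with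
`L′ : E → (E →L E →L ℝ)` (= `D²V`); `postcomp λ := (compL ℝ E F ℝ) λ` (`A ↦ λ ∘ A`), `precomp A := (compL ℝ E F ℝ).flip A` (`μ ↦ μ ∘ A`).
* §1 THE OPERATORS: `kktDeriv_apply` — the candidate derivative
  `𝒟 := ((G′ δ) ∘ fst).prod ((L′ δ − postcomp λ ∘ G″ δ) ∘ fst − precomp (G′ δ) ∘ snd)` reads `𝒟 (h, μ) = (G′ δ h, L′ δ h − λ ∘ (G″ δ h) − μ ∘ G′ δ)`;
  `kktOp_apply` — `𝒦 := (T ∘ fst).prod ((Q_V − postcomp λ₀ ∘ C₀) ∘ fst − precomp T ∘ snd)` reads `(T h, (Q_V − λ₀ ∘ C₀) h − μ ∘ T)`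
  = ALE's `K (h, μ)` at `Q := Q_V − postcomp λ₀ ∘ C₀` (the Lagrangian form).
* §2 THE DERIVATIVE **`hasFDerivAt_kktMap`** — `HasFDerivAt G (G′ δ) δ`, `HasFDerivAt G′ (G″ δ) δ`, `HasFDerivAt L (L′ δ) δ` ⟹
  `HasFDerivAt (fun x ↦ (G x.1, L x.1 − x.2.comp (G′ x.1))) 𝒟 (δ, λ)`; `fderiv_kktMap`.
* §3 THE SMALLNESS LETTER (pure operator algebra, any CLMs `A, T, P, P₀, C, C₀`, functionals `λ, λ₀`):
  `norm_comp_apply_sub_comp_apply_le` (`‖λ ∘ (C h) − λ₀ ∘ (C₀ h)‖ ≤ (‖λ‖‖C − C₀‖ + ‖λ − λ₀‖‖C₀‖)‖h‖`),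
  **`norm_kktDeriv_sub_kktOp_apply_le`** (pointwise defect `≤ (2‖A − T‖ + ‖P − P₀‖ + ‖λ‖‖C − C₀‖ + ‖λ − λ₀‖‖C₀‖)‖(h, μ)‖`,
  sup norms), **`norm_kktDeriv_sub_kktOp_le`** (`‖𝒟 − 𝒦‖ ≤` the same constant), **`norm_kktDeriv_sub_kktOp_le_of_letters`**
  (moduli `a, b, e`, sizes `Λ, ρ`: `≤ 2a + b + Λe + ρ‖C₀‖`; the `2a` is the constraint's modulus entering BOTH components).
* §4 THE END **`norm_fderiv_kktMap_sub_le`** — for ANY continuous linear `K` READING the KKT operator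
  (`K (h, μ) = (T h, P₀ h − λ₀ ∘ (C₀ h) − μ ∘ T)`, e.g. ALE's `K` coerced), on a set `s ⊆ E × (F →L ℝ)` where the three `HasFDerivAt`
  letters and the five moduli ∕ size letters hold: `∀ x ∈ s, ‖fderiv ℝ Φ x − K‖ ≤ 2a + b + Λe + ρ‖C₀‖` — HSCR
  `approximatesLinearOn_of_norm_fderiv_sub_le`'s `hc` letter VERBATIM (its `hd` = `differentiableAt_kktMap`), hence `exists_sliceBranch`'s
  `hΦ` at `c := 2a + b + Λe + ρ‖C₀‖` on a convex `s`.
* §5 toy (`example`): `E = F = ℝ`, `G = id` (`G′ = 1`, `G″ = 0`), `L = 0`: `Φ(δ, λ) = (δ, −λ)` and `𝒟 (h, μ) = (h, −μ)`.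

NOT HERE (honest): which `V, G, δ₀, λ₀` are Bałaban's and the sizes of `a, b, e, Λ, ρ` for his small-field actions ((A3) ∕ (A1c),
NC-NE7b-α UNRULED); the equivalence and `N` (ALE); the branch itself (HSCR); `C²` of the KKT branch (HSBD's primal–dual twin);
Banach-space generality is kept (no inner product needed here).  BY-NAME EFFECT ON THE WALL: NONE.  NE7b NOT PRINTED ∕ NOT PROVED;
spine PROVED 0∕9; rung (B)+1 on a FINITE torus — NOT infinite volume, NOT the mass gap, NOT Clay.  HONEST DEPENDENCY: continuum YM
on T⁴ ⇐ BetaPertH ∧ nine spine estimates (0/9 proved); BetaPertH ⇐ (D1) ∧ (D4) ∧ CAP+tail; G-an2-4 gates asym, D1 and NE2∕3∕4.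
-/

set_option autoImplicit false

noncomputable section

namespace Summit.QuantumFields.BalabanUV.T4Continuum.NE7b.KKTChartDerivative

open scoped NNReal

variable {E F : Type*} [NormedAddCommGroup E] [NormedSpace ℝ E] [NormedAddCommGroup F] [NormedSpace ℝ F]

/-! ## §1. The operators and how they act -/

/-- `postcomp λ A = λ ∘ A`. [folklore] -/
theorem postcomp_apply (lam : F →L[ℝ] ℝ) (A : E →L[ℝ] F) :
    (ContinuousLinearMap.compL ℝ E F ℝ) lam A = lam.comp A := rfl

/-- `precomp A μ = μ ∘ A`. [folklore] -/
theorem precomp_apply (A : E →L[ℝ] F) (μ : F →L[ℝ] ℝ) :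
    (ContinuousLinearMap.compL ℝ E F ℝ).flip A μ = μ.comp A := rfl

/-- **THE CANDIDATE DERIVATIVE ACTS AS** `𝒟 (h, μ) = (A h, P h − λ ∘ (C h) − μ ∘ A)`. [folklore] -/
theorem kktDeriv_apply (A : E →L[ℝ] F) (P : E →L[ℝ] E →L[ℝ] ℝ) (C : E →L[ℝ] E →L[ℝ] F) (lam : F →L[ℝ] ℝ)
    (h : E) (μ : F →L[ℝ] ℝ) :
    ((A.comp (ContinuousLinearMap.fst ℝ E (F →L[ℝ] ℝ))).prod
        ((P - ((ContinuousLinearMap.compL ℝ E F ℝ) lam).comp C).comp (ContinuousLinearMap.fst ℝ E (F →L[ℝ] ℝ)) -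
          ((ContinuousLinearMap.compL ℝ E F ℝ).flip A).comp (ContinuousLinearMap.snd ℝ E (F →L[ℝ] ℝ)))) (h, μ) =
      (A h, P h - lam.comp (C h) - μ.comp A) := rfl

/-! ## §2. The derivative of the primal–dual map -/

/-- The bilinear term `x ↦ x.2 ∘ G′(x.1)` has derivative `(h, μ) ↦ μ ∘ G′ δ + λ ∘ (G″ δ h)` at `(δ, λ)` (Leibniz rule for
operator composition, chained with `x ↦ (G′ x.1, x.2)`). [folklore] -/
theorem hasFDerivAt_snd_comp {G' : E → E →L[ℝ] F} {G'' : E → E →L[ℝ] E →L[ℝ] F} {δ : E} {lam : F →L[ℝ] ℝ}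
    (hG' : HasFDerivAt G' (G'' δ) δ) :
    HasFDerivAt (fun x : E × (F →L[ℝ] ℝ) => x.2.comp (G' x.1))
      ((((ContinuousLinearMap.compL ℝ E F ℝ) lam).comp (G'' δ)).comp (ContinuousLinearMap.fst ℝ E (F →L[ℝ] ℝ)) +
        ((ContinuousLinearMap.compL ℝ E F ℝ).flip (G' δ)).comp (ContinuousLinearMap.snd ℝ E (F →L[ℝ] ℝ)))
      (δ, lam) := by
  -- the inner map `x ↦ (x.2, G′ x.1)` and its derivative
  have h1 : HasFDerivAt (fun x : E × (F →L[ℝ] ℝ) => (x.2, G' x.1))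
      ((ContinuousLinearMap.snd ℝ E (F →L[ℝ] ℝ)).prod ((G'' δ).comp (ContinuousLinearMap.fst ℝ E (F →L[ℝ] ℝ))))
      (δ, lam) :=
    hasFDerivAt_snd.prodMk (hG'.comp (δ, lam) hasFDerivAt_fst)
  -- the outer bilinear map `(μ, A) ↦ μ ∘ A` (Leibniz rule)
  have hb : IsBoundedBilinearMap ℝ (fun p : (F →L[ℝ] ℝ) × (E →L[ℝ] F) => p.1.comp p.2) :=
    isBoundedBilinearMap_comp
  have h2 := (hb.hasFDerivAt (lam, G' δ)).comp (δ, lam) h1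
  refine h2.congr_fderiv (ContinuousLinearMap.ext fun q => ?_)
  obtain ⟨h, μ⟩ := q
  simp only [ContinuousLinearMap.coe_comp, Function.comp_apply, hb.deriv_apply, ContinuousLinearMap.prod_apply,
    ContinuousLinearMap.coe_snd', ContinuousLinearMap.coe_fst', FunLike.coe_add, Pi.add_apply, postcomp_apply,
    precomp_apply]

/-- **THE DERIVATIVE OF THE PRIMAL–DUAL MAP.**  `HasFDerivAt G (G′ δ) δ`, `HasFDerivAt G′ (G″ δ) δ`, `HasFDerivAt L (L′ δ) δ` ⟹
`Φ x = (G x.1, L x.1 − x.2 ∘ G′ x.1)` has derivative `𝒟` at `(δ, λ)` with `𝒟 (h, μ) = (G′ δ h, L′ δ h − λ ∘ (G″ δ h) − μ ∘ G′ δ)`.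
[folklore] -/
theorem hasFDerivAt_kktMap {G : E → F} {G' : E → E →L[ℝ] F} {G'' : E → E →L[ℝ] E →L[ℝ] F} {L : E → E →L[ℝ] ℝ}
    {L' : E → E →L[ℝ] E →L[ℝ] ℝ} {δ : E} {lam : F →L[ℝ] ℝ}
    (hG : HasFDerivAt G (G' δ) δ) (hG' : HasFDerivAt G' (G'' δ) δ) (hL : HasFDerivAt L (L' δ) δ) :
    HasFDerivAt (fun x : E × (F →L[ℝ] ℝ) => (G x.1, L x.1 - x.2.comp (G' x.1)))
      (((G' δ).comp (ContinuousLinearMap.fst ℝ E (F →L[ℝ] ℝ))).prod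
        ((L' δ - ((ContinuousLinearMap.compL ℝ E F ℝ) lam).comp (G'' δ)).comp (ContinuousLinearMap.fst ℝ E (F →L[ℝ] ℝ)) -
          ((ContinuousLinearMap.compL ℝ E F ℝ).flip (G' δ)).comp (ContinuousLinearMap.snd ℝ E (F →L[ℝ] ℝ))))
      (δ, lam) := by
  have h1 : HasFDerivAt (fun x : E × (F →L[ℝ] ℝ) => G x.1) ((G' δ).comp (ContinuousLinearMap.fst ℝ E (F →L[ℝ] ℝ)))
      (δ, lam) := hG.comp (δ, lam) hasFDerivAt_fst
  have h2 : HasFDerivAt (fun x : E × (F →L[ℝ] ℝ) => L x.1) ((L' δ).comp (ContinuousLinearMap.fst ℝ E (F →L[ℝ] ℝ)))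
      (δ, lam) := hL.comp (δ, lam) hasFDerivAt_fst
  have h3 := hasFDerivAt_snd_comp (lam := lam) hG'
  refine (h1.prodMk (h2.sub h3)).congr_fderiv ?_
  congr 1
  refine ContinuousLinearMap.ext fun q => ?_
  obtain ⟨h, μ⟩ := q
  simp only [FunLike.coe_sub, Pi.sub_apply, FunLike.coe_add, Pi.add_apply,
    ContinuousLinearMap.coe_comp, Function.comp_apply, ContinuousLinearMap.coe_fst', ContinuousLinearMap.coe_snd']
  abel

/-- The `fderiv` form of §2. [folklore] -/
theorem fderiv_kktMap {G : E → F} {G' : E → E →L[ℝ] F} {G'' : E → E →L[ℝ] E →L[ℝ] F} {L : E → E →L[ℝ] ℝ}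
    {L' : E → E →L[ℝ] E →L[ℝ] ℝ} {δ : E} {lam : F →L[ℝ] ℝ}
    (hG : HasFDerivAt G (G' δ) δ) (hG' : HasFDerivAt G' (G'' δ) δ) (hL : HasFDerivAt L (L' δ) δ) :
    fderiv ℝ (fun x : E × (F →L[ℝ] ℝ) => (G x.1, L x.1 - x.2.comp (G' x.1))) (δ, lam) =
      ((G' δ).comp (ContinuousLinearMap.fst ℝ E (F →L[ℝ] ℝ))).prod
        ((L' δ - ((ContinuousLinearMap.compL ℝ E F ℝ) lam).comp (G'' δ)).comp (ContinuousLinearMap.fst ℝ E (F →L[ℝ] ℝ)) -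
          ((ContinuousLinearMap.compL ℝ E F ℝ).flip (G' δ)).comp (ContinuousLinearMap.snd ℝ E (F →L[ℝ] ℝ))) :=
  (hasFDerivAt_kktMap hG hG' hL).fderiv

/-! ## §3. The smallness letter: operator algebra (pointwise, then the operator norm) -/

/-- The multiplier–curvature term, pointwise: `‖λ ∘ (C h) − λ₀ ∘ (C₀ h)‖ ≤ (‖λ‖‖C − C₀‖ + ‖λ − λ₀‖‖C₀‖)‖h‖`. [folklore] -/
theorem norm_comp_apply_sub_comp_apply_le (lam lam₀ : F →L[ℝ] ℝ) (C C₀ : E →L[ℝ] E →L[ℝ] F) (h : E) :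
    ‖lam.comp (C h) - lam₀.comp (C₀ h)‖ ≤ (‖lam‖ * ‖C - C₀‖ + ‖lam - lam₀‖ * ‖C₀‖) * ‖h‖ := by
  have e : lam.comp (C h) - lam₀.comp (C₀ h) = lam.comp ((C - C₀) h) + (lam - lam₀).comp (C₀ h) := by
    rw [sub_apply, ContinuousLinearMap.comp_sub, ContinuousLinearMap.sub_comp]
    abel
  rw [e]
  have h1 : ‖lam.comp ((C - C₀) h)‖ ≤ ‖lam‖ * ‖C - C₀‖ * ‖h‖ :=
    (lam.opNorm_comp_le ((C - C₀) h)).trans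
      (by rw [mul_assoc]; exact mul_le_mul_of_nonneg_left ((C - C₀).le_opNorm h) (norm_nonneg lam))
  have h2 : ‖(lam - lam₀).comp (C₀ h)‖ ≤ ‖lam - lam₀‖ * ‖C₀‖ * ‖h‖ :=
    ((lam - lam₀).opNorm_comp_le (C₀ h)).trans
      (by rw [mul_assoc]; exact mul_le_mul_of_nonneg_left (C₀.le_opNorm h) (norm_nonneg (lam - lam₀)))
  calc ‖lam.comp ((C - C₀) h) + (lam - lam₀).comp (C₀ h)‖
      ≤ ‖lam.comp ((C - C₀) h)‖ + ‖(lam - lam₀).comp (C₀ h)‖ := norm_add_le _ _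
    _ ≤ ‖lam‖ * ‖C - C₀‖ * ‖h‖ + ‖lam - lam₀‖ * ‖C₀‖ * ‖h‖ := add_le_add h1 h2
    _ = (‖lam‖ * ‖C - C₀‖ + ‖lam - lam₀‖ * ‖C₀‖) * ‖h‖ := by ring

/-- **THE DEFECT, POINTWISE**: for every `(h, μ)`,
`‖𝒟(h, μ) − 𝒦(h, μ)‖ ≤ (2‖A − T‖ + ‖P − P₀‖ + ‖λ‖‖C − C₀‖ + ‖λ − λ₀‖‖C₀‖)·‖(h, μ)‖` (sup norms), where
`𝒟(h, μ) = (A h, P h − λ ∘ (C h) − μ ∘ A)` and `𝒦(h, μ) = (T h, P₀ h − λ₀ ∘ (C₀ h) − μ ∘ T)`. [folklore] -/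
theorem norm_kktDeriv_sub_kktOp_apply_le (A T : E →L[ℝ] F) (P P₀ : E →L[ℝ] E →L[ℝ] ℝ) (C C₀ : E →L[ℝ] E →L[ℝ] F)
    (lam lam₀ : F →L[ℝ] ℝ) (h : E) (μ : F →L[ℝ] ℝ) :
    ‖((A h, P h - lam.comp (C h) - μ.comp A) : F × (E →L[ℝ] ℝ)) - (T h, P₀ h - lam₀.comp (C₀ h) - μ.comp T)‖ ≤
      (2 * ‖A - T‖ + ‖P - P₀‖ + (‖lam‖ * ‖C - C₀‖ + ‖lam - lam₀‖ * ‖C₀‖)) * ‖(h, μ)‖ := by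
  have hh : ‖h‖ ≤ ‖(h, μ)‖ := norm_fst_le (h, μ)
  have hμ : ‖μ‖ ≤ ‖(h, μ)‖ := norm_snd_le (h, μ)
  have hAT : 0 ≤ ‖A - T‖ := norm_nonneg (A - T)
  -- first component
  have c1 : ‖A h - T h‖ ≤ ‖A - T‖ * ‖(h, μ)‖ := by
    rw [← sub_apply]
    exact ((A - T).le_opNorm h).trans (mul_le_mul_of_nonneg_left hh hAT)
  -- second component, split into three differences
  have e2 : P h - lam.comp (C h) - μ.comp A - (P₀ h - lam₀.comp (C₀ h) - μ.comp T) =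
      (P - P₀) h - (lam.comp (C h) - lam₀.comp (C₀ h)) - μ.comp (A - T) := by
    rw [sub_apply, ContinuousLinearMap.comp_sub]
    abel
  have c2a : ‖(P - P₀) h‖ ≤ ‖P - P₀‖ * ‖(h, μ)‖ :=
    ((P - P₀).le_opNorm h).trans (mul_le_mul_of_nonneg_left hh (norm_nonneg (P - P₀)))
  have c2b : ‖lam.comp (C h) - lam₀.comp (C₀ h)‖ ≤ (‖lam‖ * ‖C - C₀‖ + ‖lam - lam₀‖ * ‖C₀‖) * ‖(h, μ)‖ :=
    (norm_comp_apply_sub_comp_apply_le lam lam₀ C C₀ h).trans (mul_le_mul_of_nonneg_left hh (by positivity))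
  have c2c : ‖μ.comp (A - T)‖ ≤ ‖A - T‖ * ‖(h, μ)‖ :=
    (μ.opNorm_comp_le (A - T)).trans (by rw [mul_comm]; exact mul_le_mul_of_nonneg_left hμ hAT)
  have c2 : ‖P h - lam.comp (C h) - μ.comp A - (P₀ h - lam₀.comp (C₀ h) - μ.comp T)‖ ≤
      (‖P - P₀‖ + (‖lam‖ * ‖C - C₀‖ + ‖lam - lam₀‖ * ‖C₀‖) + ‖A - T‖) * ‖(h, μ)‖ := by
    rw [e2]
    calc ‖(P - P₀) h - (lam.comp (C h) - lam₀.comp (C₀ h)) - μ.comp (A - T)‖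
        ≤ ‖(P - P₀) h‖ + ‖lam.comp (C h) - lam₀.comp (C₀ h)‖ + ‖μ.comp (A - T)‖ :=
          (norm_sub_le _ _).trans (add_le_add (norm_sub_le _ _) le_rfl)
      _ ≤ _ := by linarith
  -- the pair in the sup norm
  rw [Prod.mk_sub_mk, Prod.norm_def]
  refine max_le (c1.trans ?_) (c2.trans ?_)
  · have : 0 ≤ (‖A - T‖ + ‖P - P₀‖ + (‖lam‖ * ‖C - C₀‖ + ‖lam - lam₀‖ * ‖C₀‖)) * ‖(h, μ)‖ := by positivity
    linarith
  · have : 0 ≤ ‖A - T‖ * ‖(h, μ)‖ := by positivity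
    linarith

/-- **THE SMALLNESS LETTER IN OPERATOR FORM**:
`‖𝒟 − 𝒦‖ ≤ 2‖A − T‖ + ‖P − P₀‖ + ‖λ‖‖C − C₀‖ + ‖λ − λ₀‖‖C₀‖` for the explicit operators of §1. [folklore] -/
theorem norm_kktDeriv_sub_kktOp_le (A T : E →L[ℝ] F) (P P₀ : E →L[ℝ] E →L[ℝ] ℝ) (C C₀ : E →L[ℝ] E →L[ℝ] F)
    (lam lam₀ : F →L[ℝ] ℝ) :
    ‖(A.comp (ContinuousLinearMap.fst ℝ E (F →L[ℝ] ℝ))).prod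
        ((P - ((ContinuousLinearMap.compL ℝ E F ℝ) lam).comp C).comp (ContinuousLinearMap.fst ℝ E (F →L[ℝ] ℝ)) -
          ((ContinuousLinearMap.compL ℝ E F ℝ).flip A).comp (ContinuousLinearMap.snd ℝ E (F →L[ℝ] ℝ))) -
      (T.comp (ContinuousLinearMap.fst ℝ E (F →L[ℝ] ℝ))).prod
        ((P₀ - ((ContinuousLinearMap.compL ℝ E F ℝ) lam₀).comp C₀).comp (ContinuousLinearMap.fst ℝ E (F →L[ℝ] ℝ)) -
          ((ContinuousLinearMap.compL ℝ E F ℝ).flip T).comp (ContinuousLinearMap.snd ℝ E (F →L[ℝ] ℝ)))‖ ≤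
      2 * ‖A - T‖ + ‖P - P₀‖ + (‖lam‖ * ‖C - C₀‖ + ‖lam - lam₀‖ * ‖C₀‖) := by
  refine ContinuousLinearMap.opNorm_le_bound _ (by positivity) fun q => ?_
  obtain ⟨h, μ⟩ := q
  rw [sub_apply, kktDeriv_apply, kktDeriv_apply]
  exact norm_kktDeriv_sub_kktOp_apply_le A T P P₀ C C₀ lam lam₀ h μ

/-- **THE SMALLNESS LETTER FROM MODULI**: `‖A − T‖ ≤ a`, `‖P − P₀‖ ≤ b`, `‖C − C₀‖ ≤ e`, `‖λ‖ ≤ Λ`, `‖λ − λ₀‖ ≤ ρ` ⟹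
`‖𝒟 − 𝒦‖ ≤ 2a + b + Λe + ρ‖C₀‖`. [folklore] -/
theorem norm_kktDeriv_sub_kktOp_le_of_letters (A T : E →L[ℝ] F) (P P₀ : E →L[ℝ] E →L[ℝ] ℝ) (C C₀ : E →L[ℝ] E →L[ℝ] F)
    (lam lam₀ : F →L[ℝ] ℝ) {a b e Λ ρ : ℝ} (ha : ‖A - T‖ ≤ a) (hb : ‖P - P₀‖ ≤ b) (he : ‖C - C₀‖ ≤ e) (hΛ : ‖lam‖ ≤ Λ)
    (hρ : ‖lam - lam₀‖ ≤ ρ) :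
    ‖(A.comp (ContinuousLinearMap.fst ℝ E (F →L[ℝ] ℝ))).prod
        ((P - ((ContinuousLinearMap.compL ℝ E F ℝ) lam).comp C).comp (ContinuousLinearMap.fst ℝ E (F →L[ℝ] ℝ)) -
          ((ContinuousLinearMap.compL ℝ E F ℝ).flip A).comp (ContinuousLinearMap.snd ℝ E (F →L[ℝ] ℝ))) -
      (T.comp (ContinuousLinearMap.fst ℝ E (F →L[ℝ] ℝ))).prod
        ((P₀ - ((ContinuousLinearMap.compL ℝ E F ℝ) lam₀).comp C₀).comp (ContinuousLinearMap.fst ℝ E (F →L[ℝ] ℝ)) -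
          ((ContinuousLinearMap.compL ℝ E F ℝ).flip T).comp (ContinuousLinearMap.snd ℝ E (F →L[ℝ] ℝ)))‖ ≤
      2 * a + b + Λ * e + ρ * ‖C₀‖ := by
  have hΛ0 : 0 ≤ Λ := (norm_nonneg lam).trans hΛ
  have h := norm_kktDeriv_sub_kktOp_le A T P P₀ C C₀ lam lam₀
  have h1 : ‖lam‖ * ‖C - C₀‖ ≤ Λ * e :=
    mul_le_mul hΛ he (norm_nonneg (C - C₀)) hΛ0
  have h2 : ‖lam - lam₀‖ * ‖C₀‖ ≤ ρ * ‖C₀‖ := mul_le_mul_of_nonneg_right hρ (norm_nonneg C₀)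
  linarith

/-! ## §4. The END: HSCR's `hc` letter for the primal–dual chart -/

/-- **THE KKT CHART's SMALLNESS LETTER.**  Let `K` be ANY continuous linear map READING the KKT operator,
`K (h, μ) = (T h, P₀ h − λ₀ ∘ (C₀ h) − μ ∘ T)` (e.g. `…AugmentedLagrangianEquivalence.exists_kkt_equiv`'s `K` at the Lagrangian
form `Q := P₀ − postcomp λ₀ ∘ C₀`, coerced).  On a set `s` of primal–dual points where `G`, `G′`, `L` have the derivatives `G′`,
`G″`, `L′` (first coordinate) and the moduli ∕ sizes `‖G′ x.1 − T‖ ≤ a`, `‖L′ x.1 − P₀‖ ≤ b`, `‖G″ x.1 − C₀‖ ≤ e`, `‖x.2‖ ≤ Λ`,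
`‖x.2 − λ₀‖ ≤ ρ` hold: `∀ x ∈ s, ‖fderiv ℝ Φ x − K‖ ≤ 2a + b + Λe + ρ‖C₀‖` — `…HardStepChartRadius.approximatesLinearOn_of_norm_fderiv_sub_le`'s
`hc` letter VERBATIM (its `hd` is `differentiableAt_kktMap` below). [folklore] -/
theorem norm_fderiv_kktMap_sub_le {G : E → F} {G' : E → E →L[ℝ] F} {G'' : E → E →L[ℝ] E →L[ℝ] F} {L : E → E →L[ℝ] ℝ}
    {L' : E → E →L[ℝ] E →L[ℝ] ℝ} {T : E →L[ℝ] F} {P₀ : E →L[ℝ] E →L[ℝ] ℝ} {C₀ : E →L[ℝ] E →L[ℝ] F} {lam₀ : F →L[ℝ] ℝ}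
    (K : (E × (F →L[ℝ] ℝ)) →L[ℝ] (F × (E →L[ℝ] ℝ)))
    (hK : ∀ (h : E) (μ : F →L[ℝ] ℝ), K (h, μ) = (T h, P₀ h - lam₀.comp (C₀ h) - μ.comp T))
    {s : Set (E × (F →L[ℝ] ℝ))} {a b e Λ ρ : ℝ}
    (hG : ∀ x ∈ s, HasFDerivAt G (G' x.1) x.1) (hG' : ∀ x ∈ s, HasFDerivAt G' (G'' x.1) x.1)
    (hL : ∀ x ∈ s, HasFDerivAt L (L' x.1) x.1)
    (ha : ∀ x ∈ s, ‖G' x.1 - T‖ ≤ a) (hb : ∀ x ∈ s, ‖L' x.1 - P₀‖ ≤ b) (he : ∀ x ∈ s, ‖G'' x.1 - C₀‖ ≤ e)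
    (hΛ : ∀ x ∈ s, ‖x.2‖ ≤ Λ) (hρ : ∀ x ∈ s, ‖x.2 - lam₀‖ ≤ ρ) :
    ∀ x ∈ s, ‖fderiv ℝ (fun y : E × (F →L[ℝ] ℝ) => (G y.1, L y.1 - y.2.comp (G' y.1))) x - K‖ ≤
      2 * a + b + Λ * e + ρ * ‖C₀‖ := by
  intro x hx
  obtain ⟨δ, lam⟩ := x
  have hΛ0 : 0 ≤ Λ := (norm_nonneg lam).trans (hΛ (δ, lam) hx)
  have h1 : ‖lam‖ * ‖G'' δ - C₀‖ ≤ Λ * e := mul_le_mul (hΛ (δ, lam) hx) (he (δ, lam) hx) (norm_nonneg (G'' δ - C₀)) hΛ0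
  have h2 : ‖lam - lam₀‖ * ‖C₀‖ ≤ ρ * ‖C₀‖ := mul_le_mul_of_nonneg_right (hρ (δ, lam) hx) (norm_nonneg C₀)
  have ha0 : 0 ≤ a := (norm_nonneg (G' δ - T)).trans (ha (δ, lam) hx)
  have hb0 : 0 ≤ b := (norm_nonneg (L' δ - P₀)).trans (hb (δ, lam) hx)
  have he0 : 0 ≤ e := (norm_nonneg (G'' δ - C₀)).trans (he (δ, lam) hx)
  have hρ0 : 0 ≤ ρ := (norm_nonneg (lam - lam₀)).trans (hρ (δ, lam) hx)
  have hc0 : 0 ≤ 2 * a + b + Λ * e + ρ * ‖C₀‖ :=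
    add_nonneg (add_nonneg (add_nonneg (mul_nonneg zero_le_two ha0) hb0) (mul_nonneg hΛ0 he0))
      (mul_nonneg hρ0 (norm_nonneg C₀))
  rw [(hasFDerivAt_kktMap (hG (δ, lam) hx) (hG' (δ, lam) hx) (hL (δ, lam) hx)).fderiv]
  refine ContinuousLinearMap.opNorm_le_bound _ hc0 fun q => ?_
  obtain ⟨h, μ⟩ := q
  rw [sub_apply, hK h μ, kktDeriv_apply]
  refine (norm_kktDeriv_sub_kktOp_apply_le (G' δ) T (L' δ) P₀ (G'' δ) C₀ lam lam₀ h μ).trans ?_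
  refine mul_le_mul_of_nonneg_right ?_ (norm_nonneg ((h, μ) : E × (F →L[ℝ] ℝ)))
  have := ha (δ, lam) hx; have := hb (δ, lam) hx
  linarith

/-- DIFFERENTIABILITY on `s` (HSCR §2's `hd` letter). [folklore] -/
theorem differentiableAt_kktMap {G : E → F} {G' : E → E →L[ℝ] F} {G'' : E → E →L[ℝ] E →L[ℝ] F} {L : E → E →L[ℝ] ℝ}
    {L' : E → E →L[ℝ] E →L[ℝ] ℝ} {s : Set (E × (F →L[ℝ] ℝ))}
    (hG : ∀ x ∈ s, HasFDerivAt G (G' x.1) x.1) (hG' : ∀ x ∈ s, HasFDerivAt G' (G'' x.1) x.1)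
    (hL : ∀ x ∈ s, HasFDerivAt L (L' x.1) x.1) :
    ∀ x ∈ s, DifferentiableAt ℝ (fun y : E × (F →L[ℝ] ℝ) => (G y.1, L y.1 - y.2.comp (G' y.1))) x := by
  intro x hx
  obtain ⟨δ, lam⟩ := x
  exact (hasFDerivAt_kktMap (hG (δ, lam) hx) (hG' (δ, lam) hx) (hL (δ, lam) hx)).differentiableAt

/-! ## §5. Toy -/

/-- Toy: `E = F = ℝ`, `G = id` (`G′ ≡ 1`, `G″ ≡ 0`), `L ≡ 0` (`L′ ≡ 0`): the primal–dual map is `(δ, λ) ↦ (δ, −λ ∘ 1)` and §2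
returns its derivative at `(δ, λ)`. [folklore] -/
example (δ : ℝ) (lam : ℝ →L[ℝ] ℝ) :
    HasFDerivAt (fun x : ℝ × (ℝ →L[ℝ] ℝ) => (id x.1, (0 : ℝ → ℝ →L[ℝ] ℝ) x.1 - x.2.comp ((fun _ => (1 : ℝ →L[ℝ] ℝ)) x.1)))
      (((1 : ℝ →L[ℝ] ℝ).comp (ContinuousLinearMap.fst ℝ ℝ (ℝ →L[ℝ] ℝ))).prod
        (((0 : ℝ →L[ℝ] ℝ →L[ℝ] ℝ) - ((ContinuousLinearMap.compL ℝ ℝ ℝ ℝ) lam).comp (0 : ℝ →L[ℝ] ℝ →L[ℝ] ℝ)).comp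
            (ContinuousLinearMap.fst ℝ ℝ (ℝ →L[ℝ] ℝ)) -
          ((ContinuousLinearMap.compL ℝ ℝ ℝ ℝ).flip (1 : ℝ →L[ℝ] ℝ)).comp (ContinuousLinearMap.snd ℝ ℝ (ℝ →L[ℝ] ℝ))))
      (δ, lam) :=
  hasFDerivAt_kktMap (G := id) (G' := fun _ => (1 : ℝ →L[ℝ] ℝ)) (G'' := fun _ => (0 : ℝ →L[ℝ] ℝ →L[ℝ] ℝ))
    (L := (0 : ℝ → ℝ →L[ℝ] ℝ)) (L' := fun _ => (0 : ℝ →L[ℝ] ℝ →L[ℝ] ℝ))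
    ((ContinuousLinearMap.id ℝ ℝ).hasFDerivAt) (hasFDerivAt_const _ _) (hasFDerivAt_const _ _)

end Summit.QuantumFields.BalabanUV.T4Continuum.NE7b.KKTChartDerivative
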